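import Summits.MatrixMultiplication.OmegaCensus.SmallFormats.MatMul227GF3EnumSearch
import HarnessLib

/-!
# ω-census family (a): kernel `(henum)` at `(7,23)` — soundness of the checker

Cell `pub-omega` (unit `pub-omega-tensor`, gen 31), topic `Summits/MatrixMultiplication/OmegaCensus`
(sub-folder `SmallFormats`). Framing (verbatim): lottery ticket; floor = certified bounds/negative ranges.
HONEST FRAMING: bookkeeping — part 4 of 12 of the KERNEL proof of the ENUMERATION hypothesis `(henum)` of
`twentyfour_le_tensorRank_227_gf3_of_enumeration` (`MatMul22nGF3MarginalCensus`) for the six-orbit list of the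
`𝔽₃` `⟨2,2,7⟩@23` X-marginal census (desk-certified ×3 before: ENUM-X2 §6/§8). The EXCLUSION hypothesis `(hexcl)`
stays engine-side (Pa17: two code-disjoint exact engines; the IP instrument); nothing here is a bound on `ω`, and no
sentence here is 'R_𝔽₃(⟨2,2,7⟩) ≥ 24'.

Specification (`load`, `tot`, `Adm` = the class-wise clause system with digits `≤ 2` and total `23`, `InB`), the
window `7 ≤ bcnt ≤ 9` derived from the J- and row-clauses, the search-state invariants `Inv`, and the soundness
theorems `feas_of_adm`, `chk_sound`, `runCase_sound`: a passing search certifies EVERY admissible count vector within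
the case bounds as a listed leaf.
-/

namespace Summit.MatrixMultiplication.OmegaCensus.SmallFormats.Enum723


/-! ## Specification: count vectors, clause loads, admissibility -/

open Finset

/-- Load of clause `k` under the count vector `c` (classes `< 40`). -/
def load (c : ℕ → ℕ) (k : ℕ) : ℕ := ∑ a ∈ range 40, c a * inc a k

/-- Total number of terms. -/
def tot (c : ℕ → ℕ) : ℕ := ∑ a ∈ range 40, c a

/-- Number of invertible terms (classes `0–23`). -/
def bcnt (c : ℕ → ℕ) : ℕ := ∑ a ∈ range 24, c a

/-- Number of rank-one terms (classes `24–39`). -/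
def acnt (c : ℕ → ℕ) : ℕ := ∑ a ∈ Ico 24 40, c a

/-- **Admissible count vectors** (the class-wise form of `XCaps3 7 23` on a nowhere-zero marginal): every clause
load within its cap, every digit `≤ 2` (point caps `r − 3n`), total `23`. -/
def Adm (c : ℕ → ℕ) : Prop :=
  (∀ k, k < 82 → load c k ≤ cap k) ∧ (∀ a, a < 40 → c a ≤ 2) ∧ tot c = 23

/-- Digit bounds `LO ≤ c ≤ HI` on the 40 classes. -/
def InB (LO HI : List ℕ) (c : ℕ → ℕ) : Prop :=
  ∀ a, a < 40 → LO.getD a 0 ≤ c a ∧ c a ≤ HI.getD a 0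

/-! ### Table facts (by `decide`) -/

/-- `capL` has 82 entries. -/
theorem capL_length : capL.length = 82 := by decide

/-- Every incidence row has 82 entries. -/
theorem incL_length : ∀ i, i < 40 → (incL.getD i []).length = 82 := by decide

/-- Each rank-one class `24 + s` lies in its two J-clauses `2s`, `2s + 1`. -/
theorem inc_pair : ∀ s, s < 16 → inc (24 + s) (2 * s) = 1 ∧ inc (24 + s) (2 * s + 1) = 1 := by decide

/-- Row-sum of the J-block of the incidence table: `4` on invertible classes, `2` on rank-one classes. -/
theorem inc_Jsum : ∀ a, a < 40 → ∑ k ∈ range 32, inc a k = if a < 24 then 4 else 2 := by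
  intro a ha
  simp only [Finset.sum_range_succ, Finset.sum_range_zero]
  revert a; decide

/-- Row-sum of the row-plane block (`32–35`): `0` on invertible classes, `1` on rank-one classes. -/
theorem inc_Rsum : ∀ a, a < 40 → inc a 32 + inc a 33 + inc a 34 + inc a 35 = if a < 24 then 0 else 1 := by
  decide

/-- The J caps are `2`, the row-plane caps `4`. -/
theorem cap_J : ∀ k, k < 32 → cap k = 2 := by decide

/-- The row-plane caps are `4`. -/
theorem cap_R : cap 32 = 4 ∧ cap 33 = 4 ∧ cap 34 = 4 ∧ cap 35 = 4 := by decide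

/-! ### The window `7 ≤ b ≤ 9` -/

/-- Summing loads over a set of clauses, class by class. -/
theorem sum_load (c : ℕ → ℕ) (S : Finset ℕ) :
    ∑ k ∈ S, load c k = ∑ a ∈ range 40, c a * ∑ k ∈ S, inc a k := by
  simp only [load]
  rw [Finset.sum_comm]
  exact Finset.sum_congr rfl fun a _ => by rw [Finset.mul_sum]

/-- `tot = bcnt + acnt`. -/
theorem tot_eq (c : ℕ → ℕ) : tot c = bcnt c + acnt c := by
  rw [tot, bcnt, acnt, Finset.range_eq_Ico, Finset.range_eq_Ico]
  exact (Finset.sum_Ico_consecutive _ (by norm_num) (by norm_num)).symm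

/-- The four row-plane clauses give `acnt ≤ 16`. -/
theorem acnt_le (c : ℕ → ℕ) (h : Adm c) : acnt c ≤ 16 := by
  obtain ⟨hcap, -, -⟩ := h
  have h32 := hcap 32 (by norm_num); have h33 := hcap 33 (by norm_num)
  have h34 := hcap 34 (by norm_num); have h35 := hcap 35 (by norm_num)
  rw [cap_R.1] at h32; rw [cap_R.2.1] at h33; rw [cap_R.2.2.1] at h34; rw [cap_R.2.2.2] at h35
  have hs : load c 32 + load c 33 + load c 34 + load c 35 = acnt c := by
    have : load c 32 + load c 33 + load c 34 + load c 35 =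
        ∑ a ∈ range 40, c a * (inc a 32 + inc a 33 + inc a 34 + inc a 35) := by
      simp only [load, ← Finset.sum_add_distrib]
      exact Finset.sum_congr rfl fun a _ => by ring
    rw [this, acnt]
    rw [Finset.range_eq_Ico, ← Finset.sum_Ico_consecutive _ (show 0 ≤ 24 by norm_num) (show 24 ≤ 40 by norm_num)]
    have h1 : ∑ a ∈ Ico 0 24, c a * (inc a 32 + inc a 33 + inc a 34 + inc a 35) = 0 :=
      Finset.sum_eq_zero fun a ha => by
        rw [Finset.mem_Ico] at ha; rw [inc_Rsum a (by omega), if_pos ha.2, mul_zero]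
    have h2 : ∑ a ∈ Ico 24 40, c a * (inc a 32 + inc a 33 + inc a 34 + inc a 35) = ∑ a ∈ Ico 24 40, c a :=
      Finset.sum_congr rfl fun a ha => by
        rw [Finset.mem_Ico] at ha; rw [inc_Rsum a (by omega), if_neg (by omega), mul_one]
    rw [h1, h2, zero_add]
  omega

/-- The 32 J-clauses give `4·bcnt + 2·acnt ≤ 64`. -/
theorem four_bcnt_add_le (c : ℕ → ℕ) (h : Adm c) : 4 * bcnt c + 2 * acnt c ≤ 64 := by
  obtain ⟨hcap, -, -⟩ := h
  have hle : ∑ k ∈ range 32, load c k ≤ ∑ k ∈ range 32, cap k :=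
    Finset.sum_le_sum fun k hk => hcap k (by rw [Finset.mem_range] at hk; omega)
  have hc : ∑ k ∈ range 32, cap k = 64 := by
    rw [Finset.sum_congr rfl fun k hk => cap_J k (Finset.mem_range.mp hk)]; simp
  rw [hc, sum_load] at hle
  have hs : ∑ a ∈ range 40, c a * ∑ k ∈ range 32, inc a k = 4 * bcnt c + 2 * acnt c := by
    rw [Finset.sum_congr rfl fun a ha => by rw [inc_Jsum a (Finset.mem_range.mp ha)]]
    rw [bcnt, acnt, Finset.range_eq_Ico, Finset.range_eq_Ico,
      ← Finset.sum_Ico_consecutive _ (show 0 ≤ 24 by norm_num) (show 24 ≤ 40 by norm_num)]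
    have h1 : ∑ a ∈ Ico 0 24, c a * (if a < 24 then 4 else 2) = ∑ a ∈ Ico 0 24, 4 * c a :=
      Finset.sum_congr rfl fun a ha => by rw [Finset.mem_Ico] at ha; rw [if_pos ha.2]; ring
    have h2 : ∑ a ∈ Ico 24 40, c a * (if a < 24 then 4 else 2) = ∑ a ∈ Ico 24 40, 2 * c a :=
      Finset.sum_congr rfl fun a ha => by rw [Finset.mem_Ico] at ha; rw [if_neg (by omega)]; ring
    rw [h1, h2, ← Finset.mul_sum, ← Finset.mul_sum]
  omega

/-- **The window**: an admissible count vector has `7 ≤ bcnt ≤ 9` (and `bcnt + acnt = 23`). -/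
theorem window (c : ℕ → ℕ) (h : Adm c) : 7 ≤ bcnt c ∧ bcnt c ≤ 9 ∧ bcnt c + acnt c = 23 := by
  have h1 := acnt_le c h
  have h2 := four_bcnt_add_le c h
  have h3 : bcnt c + acnt c = 23 := by rw [← tot_eq]; exact h.2.2
  omega

/-! ### Soundness of the pruning rules -/

/-- The search-state invariants at prefix `p` (classes `0 … i−1` assigned). -/
structure Inv (HI : List ℕ) (i : ℕ) (p L : List ℕ) (b a ic : ℕ) : Prop where
  HIlen : HI.length = 40
  len : p.length = i
  le40 : i ≤ 40
  Llen : L.length = 82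
  hL : ∀ k, k < 82 → L.getD k 0 = ∑ t ∈ range i, pv p t * inc t k
  hb : b = ∑ t ∈ range (min i 24), pv p t
  ha : a = ∑ t ∈ Ico 24 i, pv p t
  hic : ic = ∑ t ∈ Ico i 24, HI.getD t 0

/-- Agreement of a count vector with the prefix. -/
def Agr (i : ℕ) (p : List ℕ) (c : ℕ → ℕ) : Prop := ∀ t, t < i → c t = pv p t

section Sound

variable {LO HI : List ℕ} {i : ℕ} {p L : List ℕ} {b a ic : ℕ} {c : ℕ → ℕ}

/-- A prefix load plus one unassigned digit is within the full load. -/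
theorem prefix_load_add_le (hI : Inv HI i p L b a ic) (hA : Agr i p c) {k t : ℕ} (hk : k < 82)
    (ht : i ≤ t) (ht' : t < 40) : L.getD k 0 + c t * inc t k ≤ load c k := by
  rw [hI.hL k hk, load, Finset.sum_congr rfl fun s hs => by rw [← hA s (Finset.mem_range.mp hs)],
    ← Finset.sum_range_add_sum_Ico _ hI.le40]
  refine Nat.add_le_add_left ?_ _
  exact Finset.single_le_sum (f := fun s => c s * inc s k) (fun _ _ => Nat.zero_le _)
    (Finset.mem_Ico.mpr ⟨ht, ht'⟩)

/-- An unassigned rank-one digit is bounded by its room. -/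
theorem le_room (hI : Inv HI i p L b a ic) (hadm : Adm c) (hB : InB LO HI c) (hA : Agr i p c)
    {s : ℕ} (hs : i - 24 ≤ s) (hs' : s < 16) : c (24 + s) ≤ room (HI.drop 24) L s := by
  have ht : i ≤ 24 + s := by omega
  obtain ⟨h1, h2⟩ := inc_pair s hs'
  have e1 := prefix_load_add_le hI hA (k := 2 * s) (by omega) ht (by omega)
  have e2 := prefix_load_add_le hI hA (k := 2 * s + 1) (by omega) ht (by omega)
  rw [h1, mul_one] at e1; rw [h2, mul_one] at e2
  have c1 := hadm.1 (2 * s) (by omega); have c2 := hadm.1 (2 * s + 1) (by omega)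
  have hh := (hB (24 + s) (by omega)).2
  have gd : (HI.drop 24).getD s 0 = HI.getD (24 + s) 0 := by simp [List.getD_eq_getElem?_getD]
  rw [room, gd]
  refine le_min hh (le_min ?_ ?_) <;> omega

/-- **Feasibility is necessary**: an admissible vector within bounds agreeing with the prefix passes `feas`. -/
theorem feas_of_adm (hI : Inv HI i p L b a ic) (hadm : Adm c) (hB : InB LO HI c) (hA : Agr i p c) :
    feas i b a ic (HI.drop 24) L = true := by
  obtain ⟨w1, w2, w3⟩ := window c hadm
  -- b ≤ bcnt c ≤ b + ic
  have eb : b = ∑ t ∈ range (min i 24), c t := by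
    rw [hI.hb]; exact Finset.sum_congr rfl fun t ht => (hA t (by
      have := Finset.mem_range.mp ht; omega)).symm
  have hI1 : Ico (min i 24) 24 = Ico i 24 := by ext t; simp only [Finset.mem_Ico]; omega
  have split1 : bcnt c = (∑ t ∈ range (min i 24), c t) + ∑ t ∈ Ico i 24, c t := by
    rw [bcnt, ← Finset.sum_range_add_sum_Ico _ (min_le_right i 24), hI1]
  have hb1 : b ≤ bcnt c := by rw [split1, eb]; exact Nat.le_add_right _ _
  have hb2 : bcnt c ≤ b + ic := by
    rw [split1, eb, hI.hic]
    exact Nat.add_le_add_left (Finset.sum_le_sum fun t ht => (hB t (by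
      have := (Finset.mem_Ico.mp ht).2; omega)).2) _
  -- a ≤ acnt c ≤ a + roomSum
  have ea : a = ∑ t ∈ Ico 24 i, c t := by
    rw [hI.ha]; exact Finset.sum_congr rfl fun t ht => (hA t (Finset.mem_Ico.mp ht).2).symm
  have hI2 : Ico 24 (max i 24) = Ico 24 i := by ext t; simp only [Finset.mem_Ico]; omega
  have split2 : acnt c = (∑ t ∈ Ico 24 i, c t) + ∑ t ∈ Ico (max i 24) 40, c t := by
    rw [acnt, ← Finset.sum_Ico_consecutive _ (le_max_right i 24) (max_le hI.le40 (by norm_num)), hI2]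
  have ha1 : a ≤ acnt c := by rw [split2, ea]; exact Nat.le_add_right _ _
  have hrs : ∑ t ∈ Ico (max i 24) 40, c t ≤ roomSum i (HI.drop 24) L := by
    rw [roomSum_eq i hI.le40 _ _ (by rw [List.length_drop, hI.HIlen]) hI.Llen,
      show max i 24 = (i - 24) + 24 by omega, show (40 : ℕ) = 16 + 24 by norm_num, ← Finset.sum_Ico_add']
    refine Finset.sum_le_sum fun s hs => ?_
    rw [Finset.mem_Ico] at hs
    rw [add_comm]
    exact le_room hI hadm hB hA hs.1 hs.2
  have ha2 : acnt c ≤ a + roomSum i (HI.drop 24) L := by rw [split2, ea]; omega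
  rw [feas, Nat.ble_eq]
  simp only [max_le_iff, le_min_iff]
  omega

/-- **Extending the invariants by the true digit.** -/
theorem inv_step (hI : Inv HI i p L b a ic) (hi : i < 40) (d : ℕ) :
    Inv HI (i + 1) (p ++ [d]) (bump L (incL.getD i []) d)
      (if i < 24 then b + d else b) (if i < 24 then a else a + d) (if i < 24 then ic - HI.getD i 0 else ic) := by
  have hrow := incL_length i hi
  have hlen : L.length = (incL.getD i []).length := by rw [hI.Llen, hrow]
  have pv_old : ∀ t, t < i → pv (p ++ [d]) t = pv p t := fun t ht => by
    simp only [pv]; rw [List.getD_append _ _ _ _ (by rw [hI.len]; exact ht)]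
  have pv_new : pv (p ++ [d]) i = d := by
    simp only [pv]; rw [List.getD_append_right _ _ _ _ (by rw [hI.len])]; simp [hI.len]
  refine ⟨hI.HIlen, by simp [hI.len], by omega, by rw [bump_length _ _ _ hlen, hI.Llen], fun k hk => ?_, ?_, ?_, ?_⟩
  · rw [bump_getD _ _ _ _ hlen, hI.hL k hk, Finset.sum_range_succ, pv_new,
      Finset.sum_congr rfl fun t ht => show pv (p ++ [d]) t * inc t k = pv p t * inc t k by
        rw [pv_old t (Finset.mem_range.mp ht)]]
    simp only [inc]
  · split_ifs with h24
    · rw [show min (i + 1) 24 = min i 24 + 1 by omega, Finset.sum_range_succ, show min i 24 = i by omega,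
        pv_new, hI.hb, show min i 24 = i by omega]
      exact congrArg (· + d) (Finset.sum_congr rfl fun t ht => (pv_old t (Finset.mem_range.mp ht)).symm)
    · rw [show min (i + 1) 24 = min i 24 by omega, hI.hb]
      exact Finset.sum_congr rfl fun t ht => (pv_old t (by have := Finset.mem_range.mp ht; omega)).symm
  · split_ifs with h24
    · rw [hI.ha, Finset.Ico_eq_empty_of_le (by omega), Finset.Ico_eq_empty_of_le (by omega)]
      simp
    · rw [Finset.sum_Ico_succ_top (by omega), pv_new, hI.ha]
      exact congrArg (· + d) (Finset.sum_congr rfl fun t ht => (pv_old t (Finset.mem_Ico.mp ht).2).symm)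
  · split_ifs with h24
    · rw [hI.hic, Finset.sum_eq_sum_Ico_succ_bot h24]; omega
    · rw [hI.hic, Finset.Ico_eq_empty_of_le (by omega), Finset.Ico_eq_empty_of_le (by omega)]

/-- The cap test passes on the true digit. -/
theorem leAll_of_adm (hI : Inv HI i p L b a ic) (hi : i < 40) (hadm : Adm c) (hA : Agr i p c) :
    leAll (bump L (incL.getD i []) (c i)) capL = true := by
  have hrow := incL_length i hi
  have hlen : L.length = (incL.getD i []).length := by rw [hI.Llen, hrow]
  rw [leAll_iff _ _ (by rw [bump_length _ _ _ hlen, hI.Llen, capL_length])]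
  intro k hk
  rw [bump_length _ _ _ hlen, hI.Llen] at hk
  rw [bump_getD _ _ _ _ hlen]
  exact le_trans (prefix_load_add_le hI hA hk le_rfl hi) (hadm.1 k hk)

/-- Soundness of the leaf test. -/
theorem leafOK_sound : ∀ (certs : List (List ℕ × ℕ × List ℕ)) (p : List ℕ), leafOK certs p = true →
    ∃ e ∈ certs, actW e.2.2 (repcL.getD e.2.1 []) = p
  | [], p, h => by simp [leafOK] at h
  | (v, j, w) :: rest, p, h => by
      simp only [leafOK] at h
      split_ifs at h with hv
      · exact ⟨(v, j, w), by simp, of_decide_eq_true h⟩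
      · obtain ⟨e, he, he'⟩ := leafOK_sound rest p h
        exact ⟨e, List.mem_cons_of_mem _ he, he'⟩

/-- **Soundness of the checker.** If `chk` passes from a state satisfying the invariants, every admissible count
vector within the bounds that agrees with the prefix is certified at a leaf. -/
theorem chk_sound (certs : List (List ℕ × ℕ × List ℕ)) (n : ℕ) :
    ∀ (i : ℕ) (p L : List ℕ) (b a ic : ℕ), i + n = 40 → Inv HI i p L b a ic →
      chk LO HI (HI.drop 24) certs n i p L b a ic = true →
      ∀ c : ℕ → ℕ, Adm c → InB LO HI c → Agr i p c →
        ∃ e ∈ certs, ∀ t, t < 40 → c t = (actW e.2.2 (repcL.getD e.2.1 [])).getD t 0 := by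
  induction n with
  | zero =>
      intro i p L b a ic hin hI hchk c hadm hB hA
      rw [chk, feas_of_adm hI hadm hB hA] at hchk
      simp only [Bool.not_true, Bool.false_or] at hchk
      obtain ⟨e, he, hep⟩ := leafOK_sound certs p hchk
      refine ⟨e, he, fun t ht => ?_⟩
      rw [hep]; exact hA t (by omega)
  | succ n ih =>
      intro i p L b a ic hin hI hchk c hadm hB hA
      rw [chk, feas_of_adm hI hadm hB hA] at hchk
      simp only [Bool.not_true, Bool.false_or, List.all_eq_true] at hchk
      have hi : i < 40 := by omega
      obtain ⟨hlo, hhi⟩ := hB i hi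
      have hmem : c i ∈ List.range' (LO.getD i 0) (HI.getD i 0 + 1 - LO.getD i 0) := by
        rw [List.mem_range'_1]; omega
      have h := hchk (c i) hmem
      rw [leAll_of_adm hI hi hadm hA] at h
      simp only [Bool.not_true, Bool.false_or] at h
      refine ih (i + 1) (p ++ [c i]) _ _ _ _ (by omega) (inv_step hI hi (c i)) h c hadm hB ?_
      intro t ht
      simp only [pv]
      by_cases hti : t < i
      · rw [List.getD_append _ _ _ _ (by rw [hI.len]; exact hti)]; exact hA t hti
      · have hte : t = i := by omega
        subst hte
        rw [List.getD_append_right _ _ _ _ (by rw [hI.len])]; simp [hI.len]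

/-- **Soundness of a whole case.** -/
theorem runCase_sound (certs : List (List ℕ × ℕ × List ℕ)) (hHI : HI.length = 40)
    (h : runCase LO HI certs = true) (c : ℕ → ℕ) (hadm : Adm c) (hB : InB LO HI c) :
    ∃ e ∈ certs, ∀ t, t < 40 → c t = (actW e.2.2 (repcL.getD e.2.1 [])).getD t 0 := by
  refine chk_sound certs 40 0 [] load0 0 0 _ rfl ⟨hHI, rfl, by norm_num, by simp [load0], fun k hk => ?_, by simp,
    by simp, ?_⟩ h c hadm hB fun t ht => absurd ht (Nat.not_lt_zero t)
  · rw [load0, List.getD_eq_getElem?_getD, List.getElem?_replicate]; simp [hk]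
  · rw [sumTo_eq, Finset.range_eq_Ico]

end Sound

end Summit.MatrixMultiplication.OmegaCensus.SmallFormats.Enum723
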